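import Summits.PneNP.PneNP.Theorems.SymmetryBudgetNoHiddenOrderPerPathAtomsDefs

/-!
# Switching components are sections; the point-free ATOM of a vertex (per-path canoniser, `NoHiddenOrder`)

Route `PneNP/SymmetryBudget`, `NoHiddenOrder` (stmt-PneNP-14781); memo `PER-PATH.md` §11 (R1)/(R2a). In the W-relative
vocabulary of `SymmetryBudgetNoHiddenOrderBranchSumDefs.lean` (`cellOf`, `SwComp`, `swGraph G W c` — the switching-equivalent
graph of the partition of `W` by `c`, B. Laubner, PhD thesis HU Berlin 2011, Def. 3.3.2) this file provides the step of the
(components-only) Corneil–Goldberg process that happens WITHOUT individualisation, and its iteration to a fixed point: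

* `swClosed_homogeneous` (Laubner Prop. 3.3.4, W-relative): if `B ⊆ W` is closed under `swGraph G W c`-adjacency inside `W`
  then every `v ∈ W ∖ B` is complete or empty towards each `c`-class of `B` — `B` is a SECTION;
* `equitableIn_of_swClosed`: an equitable-inside-`W` colouring stays equitable inside such a `B`;
* `swReach_cut` — cut form of reachability for `swReach G B c v` (definitions in `…PerPathAtomsDefs.lean`);
* for `atom G W c v` (the fixed point of `B ↦ swReach G B c v` from `W`, thresholds recomputed per round):
  **`atom_connected`** (cut form: the switching graph OF THE ATOM is connected — hypothesis H3 of `BranchSum.RefinementPath`),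
  **`atom_homogeneous`** (every vertex of `W ∖ atom` is complete or empty towards each `c`-class of the atom — the source of
  hypothesis H4 / `TransitionData.dropped_homogeneous`), **`equitableIn_atom`** (H2 is inherited).

With `c` the equitable refinement after an individualisation, `atom` is the next node of the components-only recursion tree on the
pointer's path (PER-PATH.md §1, rule "components of the switching graph"; halves are not needed for Theorems A and B).
No definitions here.
-/

-- `Summit.PneNP.PneNP.…` duplicates `PneNP` BY DESIGN (single-problem summit, D-0017 layout).
set_option linter.dupNamespace false

namespace Summit.PneNP.PneNP.Theorems

open Finset

namespace BranchSum

variable {V : Type*} [DecidableEq V] (G : SimpleGraph V) [DecidableRel G.Adj]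

/-! ### Closed sets of the switching graph are sections -/

omit [DecidableEq V] in
/-- **Laubner Prop. 3.3.4, W-relative.** If `B ⊆ W` is closed under switching adjacency inside `W`, then a vertex of `W` outside
`B` is complete or empty towards every colour class of `B`: for `u, u' ∈ B` of equal colour, `v ~ u ↔ v ~ u'`. -/
theorem swClosed_homogeneous {W B : Finset V} {c : V → ℕ}
    (hcl : ∀ a ∈ B, ∀ b ∈ W, (swGraph G W c).Adj a b → b ∈ B)
    {v : V} (hv : v ∈ W) (hvB : v ∉ B) {u u' : V} (hu : u ∈ B) (hu' : u' ∈ B) (hc : c u = c u') :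
    G.Adj v u ↔ G.Adj v u' := by
  -- no switching edge from `B` to `v`, so `v ~ u ↔ SwComp (c v) (c u)`, which depends on colours only
  have key : ∀ w ∈ B, (G.Adj v w ↔ SwComp G W c v w) := by
    intro w hw
    have hne : w ≠ v := fun h => hvB (h ▸ hw)
    have hnadj : ¬ (swGraph G W c).Adj w v := fun h => hvB (hcl w hw v hv h)
    rw [swGraph_adj] at hnadj
    rw [G.adj_comm, swComp_comm]
    by_contra h
    exact hnadj ⟨hne, by tauto⟩
  rw [key u hu, key u' hu', swComp_congr G rfl hc.symm]

/-- Equitability INSIDE a vertex set `W` (hypothesis H2 of `RefinementPath`, as a predicate-free statement): equal colours have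
equally many neighbours in every cell of `W`. An equitable-inside-`W` colouring is equitable inside every switching-closed
`B ⊆ W`. -/
theorem equitableIn_of_swClosed {W B : Finset V} {c : V → ℕ} (hBW : B ⊆ W)
    (hcl : ∀ a ∈ B, ∀ b ∈ W, (swGraph G W c).Adj a b → b ∈ B)
    (heq : ∀ u ∈ W, ∀ v ∈ W, c u = c v → ∀ w ∈ W,
      ((cellOf W c w).filter fun y => G.Adj u y).card = ((cellOf W c w).filter fun y => G.Adj v y).card)
    {u : V} (hu : u ∈ B) {v : V} (hv : v ∈ B) (huv : c u = c v) {w : V} (hw : w ∈ B) :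
    ((cellOf B c w).filter fun y => G.Adj u y).card = ((cellOf B c w).filter fun y => G.Adj v y).card := by
  -- split the `W`-cell of `w` into its part inside `B` (= the `B`-cell) and outside `B`
  have hsplit : ∀ x : V, ((cellOf W c w).filter fun y => G.Adj x y).card =
      ((cellOf B c w).filter fun y => G.Adj x y).card +
        (((cellOf W c w).filter fun y => y ∉ B).filter fun y => G.Adj x y).card := by
    intro x
    rw [← card_filter_add_card_filter_not (s := (cellOf W c w).filter fun y => G.Adj x y) (fun y => y ∈ B),
      filter_filter, filter_filter, filter_filter]
    congr 1
    · congr 1; ext y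
      simp only [mem_filter, mem_cellOf_iff]
      exact ⟨fun ⟨⟨_, h2⟩, h3, h4⟩ => ⟨⟨h4, h2⟩, h3⟩, fun ⟨⟨h1, h2⟩, h3⟩ => ⟨⟨hBW h1, h2⟩, h3, h1⟩⟩
    · congr 1; ext y
      simp only [mem_filter]
      tauto
  -- the outside parts agree: `u` and `v` are equally adjacent to every outside vertex of the cell
  have hout : (((cellOf W c w).filter fun y => y ∉ B).filter fun y => G.Adj u y) =
      (((cellOf W c w).filter fun y => y ∉ B).filter fun y => G.Adj v y) := by
    refine filter_congr fun y hy => ?_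
    rw [mem_filter, mem_cellOf_iff] at hy
    rw [G.adj_comm u y, G.adj_comm v y]
    exact swClosed_homogeneous G hcl hy.1.1 hy.2 hu hv huv
  have h1 := hsplit u
  have h2 := hsplit v
  have h3 := heq u (hBW hu) v (hBW hv) huv w (hBW hw)
  rw [hout] at h1
  omega

variable {G}

/-- **Cut form of reachability**: every set containing `v` but not all of `swReach G B c v` has a switching edge (w.r.t. `B`)
leaving it into `swReach`. -/
theorem swReach_cut {B : Finset V} (c : V → ℕ) {v : V} {S : Finset V} (hvS : v ∈ S)
    (hne : ¬ swReach G B c v ⊆ S) : ∃ a ∈ S ∩ swReach G B c v, ∃ b ∈ swReach G B c v \ S, (swGraph G B c).Adj a b := by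
  classical
  by_cases hvB : v ∈ B
  swap
  · -- `v ∉ B`: the reach is empty
    exfalso; apply hne
    have : ({v} ∩ B : Finset V) = ∅ := by
      rw [eq_empty_iff_forall_notMem]; intro x hx
      rw [mem_inter, mem_singleton] at hx; exact hvB (hx.1 ▸ hx.2)
    unfold swReach; rw [this]
    have hempty : ∀ n, (swExpand G B c)^[n] (∅ : Finset V) = ∅ := by
      intro n; induction n with
      | zero => rfl
      | succ n ih =>
        rw [Function.iterate_succ_apply', ih, swExpand, empty_union, filter_eq_empty_iff]
        intro b _ ⟨a, ha, _⟩; simp at ha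
    rw [hempty]; exact empty_subset _
  -- the first iterate not inside `S`
  have h0 : (swExpand G B c)^[0] ({v} ∩ B) ⊆ S := by
    intro x hx; simp only [Function.iterate_zero, id_eq, mem_inter, mem_singleton] at hx; exact hx.1 ▸ hvS
  have hex : ∃ n, ¬ (swExpand G B c)^[n] ({v} ∩ B) ⊆ S := ⟨B.card, hne⟩
  obtain ⟨n, hn, hmin⟩ : ∃ n, ¬ (swExpand G B c)^[n] ({v} ∩ B) ⊆ S ∧ ∀ m < n, (swExpand G B c)^[m] ({v} ∩ B) ⊆ S :=
    ⟨Nat.find hex, Nat.find_spec hex, fun m hm => not_not.1 (Nat.find_min hex hm)⟩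
  obtain ⟨n', rfl⟩ : ∃ n', n = n' + 1 := by
    rcases n with _ | n'
    · exact absurd h0 hn
    · exact ⟨n', rfl⟩
  have hprev := hmin n' (Nat.lt_succ_self n')
  rw [not_subset] at hn
  obtain ⟨b, hb, hbS⟩ := hn
  rw [Function.iterate_succ_apply', swExpand, mem_union] at hb
  rcases hb with hb | hb
  · exact absurd (hprev hb) hbS
  · rw [mem_filter] at hb
    obtain ⟨a, ha, hab⟩ := hb.2
    -- `a` is in the previous iterate (⊆ S and ⊆ swReach), `b` is in the next iterate (⊆ swReach)
    have hreach_a : a ∈ swReach G B c v := by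
      have hle : n' ≤ B.card ∨ B.card ≤ n' := le_total _ _
      rcases hle with hle | hle
      · -- iterates grow up to `|B|`
        have : (swExpand G B c)^[n'] ({v} ∩ B) ⊆ (swExpand G B c)^[B.card] ({v} ∩ B) := by
          obtain ⟨k, hk⟩ := Nat.exists_eq_add_of_le hle
          rw [hk, add_comm, Function.iterate_add_apply]
          exact subset_iterate_swExpand B c _ k
        exact this ha
      · -- beyond `|B|` the iterates are stationary
        have hst := iterate_swExpand_stable (G := G) c ({v} ∩ B) (n := B.card)
          (by rw [Function.iterate_succ_apply']; exact swExpand_iterate_card c inter_subset_right) n' hle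
        unfold swReach; rw [← hst]; exact ha
    exact ⟨a, mem_inter.2 ⟨hprev ha, hreach_a⟩, b, mem_sdiff.2 ⟨swReach_closed c v hreach_a hb.1 hab, hbS⟩, hab⟩

/-- **The switching graph OF THE ATOM is connected** (cut form, hypothesis H3 of `BranchSum.RefinementPath`). -/
theorem atom_connected {W : Finset V} (c : V → ℕ) {v : V} (hv : v ∈ W) {S : Finset V} (hS : S ⊆ atom G W c v)
    (hSne : S.Nonempty) (hSA : S ≠ atom G W c v) :
    ∃ a ∈ S, ∃ b ∈ atom G W c v \ S, (swGraph G (atom G W c v) c).Adj a b := by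
  classical
  set A := atom G W c v with hA
  have hfix : swReach G A c v = A := swReach_atom W c v
  have hvA : v ∈ A := self_mem_atom c hv
  by_cases hvS : v ∈ S
  · have hne : ¬ swReach G A c v ⊆ S := by rw [hfix]; exact fun h => hSA (Subset.antisymm hS h)
    obtain ⟨a, ha, b, hb, hab⟩ := swReach_cut c hvS hne
    rw [hfix] at hb
    exact ⟨a, (mem_inter.1 ha).1, b, hb, hab⟩
  · -- work from the complement, which contains `v`
    have hvS' : v ∈ A \ S := mem_sdiff.2 ⟨hvA, hvS⟩
    have hne : ¬ swReach G A c v ⊆ A \ S := by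
      rw [hfix]; intro h
      obtain ⟨s, hs⟩ := hSne
      exact (mem_sdiff.1 (h (hS hs))).2 hs
    obtain ⟨a, ha, b, hb, hab⟩ := swReach_cut c hvS' hne
    rw [hfix, mem_sdiff] at hb
    have hbS : b ∈ S := by
      by_contra hbS; exact hb.2 (mem_sdiff.2 ⟨hb.1, hbS⟩)
    have ha' := mem_sdiff.1 (mem_inter.1 ha).1
    exact ⟨b, hbS, a, mem_sdiff.2 ⟨ha'.1, ha'.2⟩, hab.symm⟩

/-- Every vertex of `W` dropped by round `n` is complete or empty towards each colour class of the round-`n` block. -/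
theorem iterate_atomStep_homogeneous {W : Finset V} (c : V → ℕ) (v : V) (n : ℕ) :
    ∀ w ∈ W, w ∉ (fun B => swReach G B c v)^[n] W →
      ∀ u ∈ (fun B => swReach G B c v)^[n] W, ∀ u' ∈ (fun B => swReach G B c v)^[n] W,
        c u = c u' → (G.Adj w u ↔ G.Adj w u') := by
  induction n with
  | zero => intro w hw hw'; exact absurd hw hw'
  | succ n ih =>
    intro w hw hwB' u hu u' hu' hc
    rw [Function.iterate_succ_apply'] at hwB' hu hu'
    set B := (fun B => swReach G B c v)^[n] W with hB
    by_cases hwB : w ∈ B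
    · -- dropped at this round: the new block is switching-closed inside `B`
      exact swClosed_homogeneous G (fun a ha b hb hab => swReach_closed c v ha hb hab) hwB hwB' hu hu' hc
    · exact ih w hw hwB u (swReach_subset B c v hu) u' (swReach_subset B c v hu') hc

/-- Equitability inside the block is inherited by every round. -/
theorem equitableIn_iterate_atomStep {W : Finset V} {c : V → ℕ} (v : V)
    (heq : ∀ u ∈ W, ∀ u' ∈ W, c u = c u' → ∀ w ∈ W,
      ((cellOf W c w).filter fun y => G.Adj u y).card = ((cellOf W c w).filter fun y => G.Adj u' y).card) (n : ℕ) :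
    ∀ u ∈ (fun B => swReach G B c v)^[n] W, ∀ u' ∈ (fun B => swReach G B c v)^[n] W, c u = c u' →
      ∀ w ∈ (fun B => swReach G B c v)^[n] W,
        ((cellOf ((fun B => swReach G B c v)^[n] W) c w).filter fun y => G.Adj u y).card =
          ((cellOf ((fun B => swReach G B c v)^[n] W) c w).filter fun y => G.Adj u' y).card := by
  induction n with
  | zero => exact heq
  | succ n ih =>
    intro u hu u' hu' hc w hw
    rw [Function.iterate_succ_apply'] at hu hu' hw ⊢
    set B := (fun B => swReach G B c v)^[n] W with hB
    exact equitableIn_of_swClosed G (swReach_subset B c v) (fun a ha b hb hab => swReach_closed c v ha hb hab) ih hu hu' hc hw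

/-- **Dropped vertices are homogeneous towards the atom** (the source of hypothesis H4 / `TransitionData.dropped_homogeneous`):
every `w ∈ W ∖ atom` is complete or empty towards each colour class of `atom G W c v`. -/
theorem atom_homogeneous {W : Finset V} (c : V → ℕ) (v : V) {w : V} (hw : w ∈ W) (hwA : w ∉ atom G W c v)
    {u u' : V} (hu : u ∈ atom G W c v) (hu' : u' ∈ atom G W c v) (hc : c u = c u') : G.Adj w u ↔ G.Adj w u' :=
  iterate_atomStep_homogeneous c v _ w hw hwA u hu u' hu' hc

/-- **Equitability inside the atom** (hypothesis H2 is inherited from `W`). -/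
theorem equitableIn_atom {W : Finset V} {c : V → ℕ} (v : V)
    (heq : ∀ u ∈ W, ∀ u' ∈ W, c u = c u' → ∀ w ∈ W,
      ((cellOf W c w).filter fun y => G.Adj u y).card = ((cellOf W c w).filter fun y => G.Adj u' y).card)
    {u : V} (hu : u ∈ atom G W c v) {u' : V} (hu' : u' ∈ atom G W c v) (hc : c u = c u') {w : V} (hw : w ∈ atom G W c v) :
    ((cellOf (atom G W c v) c w).filter fun y => G.Adj u y).card =
      ((cellOf (atom G W c v) c w).filter fun y => G.Adj u' y).card :=
  equitableIn_iterate_atomStep v heq _ u hu u' hu' hc w hw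

end BranchSum

end Summit.PneNP.PneNP.Theorems
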